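import Summits.Parity.GeneralizedHardyLittlewood.Theses.ConvexityCrossing

/-!
# Route `ConvexityCrossing` — the `[assembly]` item (stmt-Parity-32199)

decomp-parity node «ConvexityCrossing» (lens-5 g8; critic CLEARED HOME/STATUS.md l.386, CRITIC-LEDGER row 75 as
an axis registration; route born rev 0 by lens-5 g9, commit cf14d7dcb05b, STATUS l.431): the assembly
`BoundedSiegelZeroQuality → FixedUpper → UniformUpperGivenFixed → ConvexityFails → ConvexityLift →
UniformLowerGivenFixed → GeneralizedHardyLittlewood` is literally the route's gate-written deciding theorem `closes`
(D-0027 §2.1), curried.  Hand by the cell's prover-class seat (census-1 g9); no mathematics beyond the route file.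
-/

namespace Summit.Parity.GeneralizedHardyLittlewood.Theses.ConvexityCrossing

/-- **The `[assembly]` item holds** (stmt-Parity-32199): the six route items imply
`GeneralizedHardyLittlewood`, by the route's deciding theorem `closes`. -/
theorem assembly_proof : Assembly :=
  fun hQ hFU hUU hC hL hUL => closes hQ hFU hUU hC hL hUL

end Summit.Parity.GeneralizedHardyLittlewood.Theses.ConvexityCrossing
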